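import Mathlib
import Literature.NumberTheory.LFunctions.Zhang2022.TypedSection16BLocal
import Literature.NumberTheory.LFunctions.Zhang2022.TypedSection16BR2
import Literature.NumberTheory.LFunctions.Zhang2022.Section18DefsE
import HarnessLib

/-!
# Zhang (2022) §16 (16.14)–(16.16): the `𝔢ⱼ`-carrying displays PARAMETRISED over the value of `e″₁ⱼ`
# (RT-05 E-twins `…E e1pp`, ZHANG-L ruling R-28; rows G-L4t10-1 / G-num2-1 / D-G-num2-1) — typed
# statements, `rfl` bridges to the printed instances, and the (16.15) bookkeeping edge at the parameter

Topic `Literature/NumberTheory/LFunctions/Zhang2022` (Landau–Siegel audit tree; verdict-neutral).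
Y. Zhang, *Discrete mean estimates and the Landau–Siegel zero*, arXiv:2211.02515v1 (2022)
[Zhang2022LandauSiegel] — **an unrefereed manuscript under adjudication. Every `def … : Prop` below is a
CLAIM of the manuscript (a display of §16) read at a PARAMETRISED value of the Appendix-B constant `e″₁ⱼ`,
STATED NOT ASSERTED; nothing here asserts or denies Theorems 1–2 of the source or says anything about
Landau–Siegel zeros.**

WHY (RT-05, zl-lead R-22/R-28; numbers): the constants `𝔢ⱼ = (e₁ⱼ + ι₂e₂ⱼ)(ῑ₃e₃ⱼ + ῑ₄e₂ⱼ)`,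
`e₁ⱼ = e′₁ⱼ − e″₁ⱼ` of Lemma 15.1 enter §16 through u035 → (16.14) → u037 → (16.15) → u042 → (16.16)
(`Typed.Section16B.*`, `frake j` = `Section18Defs.frake`, built on the STATED `e″₁ⱼ = e1ppj j`). The cell's
rows G-L4t10-1 / G-num2-1 (refuted-as-printed) and D-G-num2-1 record that Appendix B's own computation
DERIVES a different value, `e″₁ⱼ = −jπi·b*` (`AppendixB.e1ppD`, `AppendixB.e1ppD_eq`; kernel:
`Numerics.not_StepB_u015c`, `Numerics.appB3_chain_inconsistent`, `e1pp_delta_one_norm_bounds`), so along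
(A)-instances at most one of the two readings of each `𝔢ⱼ`-display is derivable by the manuscript's route.
Ruling R-28 (RT-05 ADOPTED, 2026-08-26T23:40Z) carries every `𝔢ⱼ`-display PARAMETRISED over
`e1pp : ℕ → ℂ` via `frakeE e1pp j` (`Section18DefsE`, `frake = frakeE e1ppj`, `frakeD = frakeE e1ppD` by
`rfl`), the skeleton being instantiated at the DERIVED `e1ppD`; printed decls stay byte-untouched. This
file provides the §16 twins the ruling names for this seat — `Eq16_15E`, `Step16_u042RE`, `Eq16_16R2E` —
together with the twins of the `𝔢ⱼ`-carrying Block-A nodes on the discharge route (`Step16_u035LwE`,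
`Eq16_14LE`, `Step16_u037RLE` — local readings of `TypedSection16BLocal`, F16B-1; `Inline16_nsetRemovableE`;
the two-piece `Step16_u042R2E`), each with its `rfl` bridge `XE e1ppj c′ = X c′`, and the bookkeeping
edge `eq16_15E_of_repairL` (= `eq16_15_of_repairL` at the parameter; the proof treats `𝔢ⱼ` as an opaque
complex number — constant-AGNOSTIC in the sense of R-28 C4). The §16 objects (`calS2`, `b1coef`,
`varpi2`, `varpi2loc`, `nuConvChi`, `frakp`, `tau3R`, …) are used BY NAME; nothing printed is restated
under a new name except with `frake j ↦ frakeE e1pp j`. No instance, no notation.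

In words, at the instance of record `e1pp = AppendixB.e1ppD`: these are the displays (16.14)–(16.16) of
§16 with the DERIVED constant `e″₁ⱼ = −jπi·b*` (App. B's own computation), NOT the value stated in
Lemma 15.1/(B.3).

## References

* Y. Zhang, arXiv:2211.02515v1 (2022), §16 (16.14)–(16.16) pp. 93–95 (tex L4619–L4673); §15
  Lemma 15.1 p. 86; App. B (B.3) p. 107. [cite: Zhang2022LandauSiegel, §16 pp.93–95; Lemma 15.1]
-/

noncomputable section

open Complex Real ComplexConjugate Filter Topology
open Literature.NumberTheory.LFunctions.Zhang2022
open Literature.NumberTheory.LFunctions.Zhang2022.Skeleton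
open Literature.NumberTheory.LFunctions.Zhang2022.Typed.Section16A

namespace Literature.NumberTheory.LFunctions.Zhang2022.Typed.Section16B

/-! ## The `𝔢ⱼ`-carrying §16 displays at the parameter `e1pp` -/

/-- **u035 (tex L4619), local reading, derivable rate, at the parameter `e″ = e1pp`** (E-twin of
`Step16_u035Lw`, F16B-1 × RT-05): `Σ_{(m,𝔮)=1} b(m₁m)χ(m₁m)ϖ₂ⱼ^loc(m)/m = 𝔢ⱼ[e1pp]χ(m₁)τ₂(m₁) +
O((α𝓛 + 𝓛⁻⁷)τ₂(m₁))`, `𝔢ⱼ[e1pp] = frakeE e1pp j`. NOT PRINTED in this form; rows G-L4t10-1 / G-num2-1 /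
D-G-num2-1 (RT-05): at `e1pp = e1ppD` this is the display with the DERIVED `e″₁ⱼ = −jπi·b*`. CLAIM.
[cite: Zhang2022LandauSiegel, §16 p.93; §15 Lemma 15.1] -/
def Step16_u035LwE (e1pp : ℕ → ℂ) (c' : ℝ) : Prop :=
  ∃ C : ℝ, ForAllLarge fun D _ χ => AssumptionA D χ → ∀ j ∈ ({1, 2} : Finset ℕ),
    ∀ m₁ : ℕ, m₁ ∈ nset (frakq D) → (m₁ : ℝ) < bigT D →
      ‖(∑ m ∈ (Finset.Ico 1 ⌈bigP D⌉₊).filter (fun m => Nat.Coprime m (frakq D)),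
          bcoef D (m₁ * m) * χ ((m₁ * m : ℕ) : ZMod D) * varpi2loc c' χ j m / (m : ℂ)) -
        frakeE e1pp j * χ (m₁ : ZMod D) * (m₁.divisors.card : ℂ)‖ ≤
        C * (alpha D * ell D + (ell D ^ 7)⁻¹) * m₁.divisors.card

/-- **(16.14) (tex L4623), local reading, at the parameter `e″ = e1pp`** (E-twin of `Eq16_14L`): for
`n₁ ∈ 𝔫(𝔮)`, `n₁ < T`, `Σ_{(n,𝔮)=1} b₁(n₁n)ϖ₂ⱼ^loc(n)/n = 𝔢ⱼ[e1pp] Σ_{n₁=l₁m₁} χ(m₁)τ₂(m₁)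
Σ_{(l,𝔮)=1} ϖ₂ⱼ^loc(l)/(l(l₁l)^{β₃}) g*(T²/(l₁l)) + O(D^{−c})`. NOT PRINTED in this form; RT-05 rows
G-L4t10-1 / G-num2-1 / D-G-num2-1 (DERIVED `e″₁ⱼ = −jπi·b*` at `e1ppD`). CLAIM.
[cite: Zhang2022LandauSiegel, §16 (16.14) p.93] -/
def Eq16_14LE (e1pp : ℕ → ℂ) (c' : ℝ) : Prop :=
  ∃ c : ℝ, 0 < c ∧ ∃ C : ℝ, ForAllLarge fun D _ χ => AssumptionA D χ → ∀ j ∈ ({1, 2} : Finset ℕ),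
    ∀ n₁ : ℕ, n₁ ∈ nset (frakq D) → (n₁ : ℝ) < bigT D →
      ‖(∑ n ∈ (Finset.Ico 1 ⌈bigP D⌉₊).filter (fun n => Nat.Coprime n (frakq D)),
          b1coef c' χ (n₁ * n) * varpi2loc c' χ j n / (n : ℂ)) -
        frakeE e1pp j * ∑ x ∈ n₁.divisorsAntidiagonal, χ (x.2 : ZMod D) * (x.2.divisors.card : ℂ) *
          ∑ l ∈ (Finset.Ico 1 ⌈2 * bigT D ^ 2⌉₊).filter (fun l => Nat.Coprime l (frakq D)),
            varpi2loc c' χ j l / ((l : ℂ) * (((x.1 * l : ℕ) : ℂ)) ^ beta3 c' D) *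
              (gstar D (bigT D ^ 2 / ((x.1 * l : ℕ) : ℝ)) : ℂ)‖ ≤
      C * (D : ℝ) ^ (-c)

/-- **u037 REPAIRED (G-L4t5-1), local reading, at the parameter `e″ = e1pp`** (E-twin of
`Step16_u037RL`): `Σ_{(n,𝔮)=1} b₁(n₁n)ϖ₂ⱼ^loc(n)/n = 𝔢ⱼ[e1pp] Σ_{m₁∣n₁} χ(m₁)τ₂(m₁) + O(τ₃(n₁)𝓛⁻⁷ +
D^{−c})` for each `n₁ ∈ 𝔫(𝔮)`, `n₁ < T`. NOT PRINTED; RT-05 rows G-L4t10-1 / G-num2-1 / D-G-num2-1 (DERIVED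
`e″₁ⱼ` at `e1ppD`). CLAIM. [cite: Zhang2022LandauSiegel, §16 p.94 (u037)] -/
def Step16_u037RLE (e1pp : ℕ → ℂ) (c' : ℝ) : Prop :=
  ∃ c : ℝ, 0 < c ∧ ∃ C : ℝ, ForAllLarge fun D _ χ => AssumptionA D χ → ∀ j ∈ ({1, 2} : Finset ℕ),
    ∀ n₁ : ℕ, n₁ ∈ nset (frakq D) → (n₁ : ℝ) < bigT D →
      ‖(∑ n ∈ (Finset.Ico 1 ⌈bigP D⌉₊).filter (fun n => Nat.Coprime n (frakq D)),
          b1coef c' χ (n₁ * n) * varpi2loc c' χ j n / (n : ℂ)) -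
        frakeE e1pp j * ∑ m₁ ∈ n₁.divisors, χ (m₁ : ZMod D) * (m₁.divisors.card : ℂ)‖ ≤
      C * (tau3R n₁ * (ell D ^ 7)⁻¹ + (D : ℝ) ^ (-c))

open scoped Classical in
/-- **(16.15) (tex L4635) at the parameter `e″ = e1pp`** (E-twin of `Eq16_15`, R-28 C2):
"`Σ_n b₁(n)ϖ₂ⱼ(n)/n = 𝔢ⱼ[e1pp] Σ_{n₁∈𝔫(𝔮), n₁<T} ϖ₂ⱼ(n₁)(ν∗χ)(n₁)/n₁ + O(1/𝓛)`". The printed node is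
the instance `e1pp = e1ppj` (`eq16_15E_e1ppj`, `rfl`); the instance of record is `e1pp = AppendixB.e1ppD`
(DERIVED `e″₁ⱼ = −jπi·b*`, App. B's own computation, NOT the value stated in Lemma 15.1/(B.3); rows
G-L4t10-1 / G-num2-1 / D-G-num2-1, RT-05). CLAIM. [cite: Zhang2022LandauSiegel, §16 (16.15) p.94] -/
def Eq16_15E (e1pp : ℕ → ℂ) (c' : ℝ) : Prop :=
  ∃ C : ℝ, ForAllLarge fun D _ χ => AssumptionA D χ → ∀ j ∈ ({1, 2} : Finset ℕ),
    ‖(∑ n ∈ Finset.Ico 1 ⌈bigP D⌉₊, b1coef c' χ n * varpi2 c' χ j n / (n : ℂ)) -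
        frakeE e1pp j * ∑ n₁ ∈ (Finset.Ico 1 ⌈bigT D⌉₊).filter (fun n₁ => n₁ ∈ nset (frakq D)),
          varpi2 c' χ j n₁ * nuConvChi χ n₁ / (n₁ : ℂ)‖ ≤ C * (ell D)⁻¹

open scoped Classical in
/-- **"the constraint `n₁ ∈ 𝔫(𝔮)` can be removed" (tex L4638) at the parameter `e″ = e1pp`** (E-twin of
`Inline16_nsetRemovable`; both sides carry the factor `𝔢ⱼ[e1pp]`). NOT PRINTED rate (`O(1/𝓛)` as in the
printed node); RT-05 rows G-L4t10-1 / G-num2-1 / D-G-num2-1. CLAIM. [cite: Zhang2022LandauSiegel, §16 p.94] -/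
def Inline16_nsetRemovableE (e1pp : ℕ → ℂ) (c' : ℝ) : Prop :=
  ∃ C : ℝ, ForAllLarge fun D _ χ => AssumptionA D χ → ∀ j ∈ ({1, 2} : Finset ℕ),
    ‖(frakeE e1pp j * ∑ n₁ ∈ (Finset.Ico 1 ⌈bigT D⌉₊).filter (fun n₁ => n₁ ∈ nset (frakq D)),
          varpi2 c' χ j n₁ * nuConvChi χ n₁ / (n₁ : ℂ)) -
        frakeE e1pp j * ∑ n₁ ∈ Finset.Ico 1 ⌈bigT D⌉₊, varpi2 c' χ j n₁ * nuConvChi χ n₁ / (n₁ : ℂ)‖ ≤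
      C * (ell D)⁻¹

/-- **u042 with the transmitted (max-merged) rate, at the parameter `e″ = e1pp`** (E-twin of
`Step16_u042R`, R-28 C2): `Σ_n b₁(n)ϖ₂ⱼ(n)/n = (𝔞𝔢ⱼ[e1pp]/𝔭)(φ(D)/D)L′(1,χ) + O((1+|L′(1,χ)|)³/𝓛)`.
NOT PRINTED; RT-05 rows G-L4t10-1 / G-num2-1 / D-G-num2-1 (DERIVED `e″₁ⱼ` at `e1ppD`). CLAIM.
[cite: Zhang2022LandauSiegel, §16 p.94 (u042)] -/
def Step16_u042RE (e1pp : ℕ → ℂ) (c' : ℝ) : Prop :=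
  ∃ C : ℝ, ForAllLarge fun D _ χ => AssumptionA D χ → ∀ j ∈ ({1, 2} : Finset ℕ),
    ‖(∑ n ∈ Finset.Ico 1 ⌈bigP D⌉₊, b1coef c' χ n * varpi2 c' χ j n / (n : ℂ)) -
        (frakA χ : ℂ) * frakeE e1pp j / frakp χ * ((Nat.totient D : ℂ) / (D : ℂ)) * deriv χ.LFunction 1‖ ≤
      C * (1 + ‖deriv χ.LFunction 1‖) ^ 3 * (ell D)⁻¹

/-- **u042 with the TWO-PIECE transmitted rate, at the parameter `e″ = e1pp`** (E-twin of the inline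
statement of `Typed.Section16B.step16_u042R2_of_repair`, zl-w16-p4 p473530): error
`C·(𝓛⁻¹ + (1+|L′(1,χ)|)³𝓛⁻⁴)`. NOT PRINTED; RT-05 rows as above. CLAIM.
[cite: Zhang2022LandauSiegel, §16 p.94 (u042)] -/
def Step16_u042R2E (e1pp : ℕ → ℂ) (c' : ℝ) : Prop :=
  ∃ C : ℝ, ForAllLarge fun D _ χ => AssumptionA D χ → ∀ j ∈ ({1, 2} : Finset ℕ),
    ‖(∑ n ∈ Finset.Ico 1 ⌈bigP D⌉₊, b1coef c' χ n * varpi2 c' χ j n / (n : ℂ)) -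
        (frakA χ : ℂ) * frakeE e1pp j / frakp χ * ((Nat.totient D : ℂ) / (D : ℂ)) * deriv χ.LFunction 1‖ ≤
      C * ((ell D)⁻¹ + (1 + ‖deriv χ.LFunction 1‖) ^ 3 * (ell D ^ 4)⁻¹)

/-- **(16.16) in the two-piece transmitted reading, at the parameter `e″ = e1pp`** (E-twin of the RT-03
node `Eq16_16R2`, R-28 C2 — the skeleton binder of record becomes `Eq16_16R2E AppendixB.e1ppD c′`):
`𝒮₂ⱼ = 𝔞𝔢ⱼ[e1pp](φ(D)/D)L′(1,χ) + O(𝓛⁻¹ + (1+|L′(1,χ)|)³𝓛⁻⁴)`, `j = 1, 2`. NOT PRINTED (printed (16.16):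
`O(1/𝓛⁴)` at the stated `e″`); rows G-L4t5-1 / G-L4t5-2 / G-d57-1 (rate) and G-L4t10-1 / G-num2-1 /
D-G-num2-1 (constant: DERIVED `e″₁ⱼ = −jπi·b*`, App. B's own computation, not the value stated in Lemma
15.1/(B.3)). Bridge: `eq16_16R2E_e1ppj` (`rfl`). CLAIM. [cite: Zhang2022LandauSiegel, §16 (16.16) p.95] -/
def Eq16_16R2E (e1pp : ℕ → ℂ) (c' : ℝ) : Prop :=
  ∃ C : ℝ, ForAllLarge fun D _ χ => AssumptionA D χ → ∀ j ∈ ({1, 2} : Finset ℕ),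
    ‖calS2 c' χ j - (frakA χ : ℂ) * frakeE e1pp j * ((Nat.totient D : ℂ) / (D : ℂ)) *
        deriv χ.LFunction 1‖ ≤
      C * ((ell D)⁻¹ + (1 + ‖deriv χ.LFunction 1‖) ^ 3 * (ell D ^ 4)⁻¹)

/-! ## `rfl` bridges: the printed-constant nodes are the instances `e1pp = e1ppj` -/

/-- `Step16_u035LwE e1ppj = Step16_u035Lw` (stated `e″`). [cite: Zhang2022LandauSiegel, §16 p.93] -/
theorem step16_u035LwE_e1ppj (c' : ℝ) : Step16_u035LwE e1ppj c' = Step16_u035Lw c' := rfl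

/-- `Eq16_14LE e1ppj = Eq16_14L` (stated `e″`). [cite: Zhang2022LandauSiegel, §16 (16.14) p.93] -/
theorem eq16_14LE_e1ppj (c' : ℝ) : Eq16_14LE e1ppj c' = Eq16_14L c' := rfl

/-- `Step16_u037RLE e1ppj = Step16_u037RL` (stated `e″`). [cite: Zhang2022LandauSiegel, §16 p.94] -/
theorem step16_u037RLE_e1ppj (c' : ℝ) : Step16_u037RLE e1ppj c' = Step16_u037RL c' := rfl

/-- `Eq16_15E e1ppj = Eq16_15` (stated `e″`). [cite: Zhang2022LandauSiegel, §16 (16.15) p.94] -/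
theorem eq16_15E_e1ppj (c' : ℝ) : Eq16_15E e1ppj c' = Eq16_15 c' := rfl

/-- `Inline16_nsetRemovableE e1ppj = Inline16_nsetRemovable` (stated `e″`).
[cite: Zhang2022LandauSiegel, §16 p.94] -/
theorem inline16_nsetRemovableE_e1ppj (c' : ℝ) :
    Inline16_nsetRemovableE e1ppj c' = Inline16_nsetRemovable c' := rfl

/-- `Step16_u042RE e1ppj = Step16_u042R` (stated `e″`). [cite: Zhang2022LandauSiegel, §16 p.94] -/
theorem step16_u042RE_e1ppj (c' : ℝ) : Step16_u042RE e1ppj c' = Step16_u042R c' := rfl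

/-- `Eq16_16R2E e1ppj = Eq16_16R2` (stated `e″`; the RT-03 node).
[cite: Zhang2022LandauSiegel, §16 (16.16) p.95] -/
theorem eq16_16R2E_e1ppj (c' : ℝ) : Eq16_16R2E e1ppj c' = Eq16_16R2 c' := rfl

/-- The two-piece u042 implies the max-merged one, at every parameter (`𝓛⁻⁴ ≤ 𝓛⁻¹`, `1 ≤ (1+|L′|)³`).
[cite: Zhang2022LandauSiegel, §16 p.94 (u042)] -/
theorem step16_u042RE_of_R2E (e1pp : ℕ → ℂ) (c' : ℝ) (h : Step16_u042R2E e1pp c') :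
    Step16_u042RE e1pp c' := by
  obtain ⟨C, D₀, hC⟩ := h
  refine ⟨2 * max C 0, max D₀ ⌈Real.exp 1⌉₊, fun D _ χ hD hq hp hA j hj => ?_⟩
  have e := hC D χ (le_trans (le_max_left _ _) hD) hq hp hA j hj
  have hD1 : ⌈Real.exp 1⌉₊ ≤ D := le_trans (le_max_right _ _) hD
  have hL : (1 : ℝ) ≤ ell D := by
    have h : Real.exp 1 ≤ D := le_trans (Nat.le_ceil _) (by exact_mod_cast hD1)
    exact (Real.le_log_iff_exp_le (lt_of_lt_of_le (Real.exp_pos _) h)).mpr h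
  refine le_trans e ?_
  set L := ell D with hLdef
  set x := ‖deriv χ.LFunction 1‖ with hx
  have hx0 : 0 ≤ x := norm_nonneg _
  have hL0 : 0 < L := by linarith
  have hcube : 1 ≤ (1 + x) ^ 3 := one_le_pow₀ (le_add_of_nonneg_right hx0)
  have hinv : (L ^ 4)⁻¹ ≤ L⁻¹ := by
    refine inv_anti₀ hL0 ?_
    calc L = L ^ 1 := (pow_one _).symm
      _ ≤ L ^ 4 := pow_le_pow_right₀ hL (by norm_num)
  have hLi : 0 ≤ L⁻¹ := inv_nonneg.mpr hL0.le
  have hsum : L⁻¹ + (1 + x) ^ 3 * (L ^ 4)⁻¹ ≤ 2 * (1 + x) ^ 3 * L⁻¹ := by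
    have h1 : L⁻¹ ≤ (1 + x) ^ 3 * L⁻¹ := by
      calc L⁻¹ = 1 * L⁻¹ := (one_mul _).symm
        _ ≤ (1 + x) ^ 3 * L⁻¹ := mul_le_mul_of_nonneg_right hcube hLi
    have h2 : (1 + x) ^ 3 * (L ^ 4)⁻¹ ≤ (1 + x) ^ 3 * L⁻¹ :=
      mul_le_mul_of_nonneg_left hinv (le_trans zero_le_one hcube)
    linarith
  have hnn : 0 ≤ L⁻¹ + (1 + x) ^ 3 * (L ^ 4)⁻¹ :=
    add_nonneg hLi (mul_nonneg (le_trans zero_le_one hcube) (inv_nonneg.mpr (pow_nonneg hL0.le 4)))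
  calc C * (L⁻¹ + (1 + x) ^ 3 * (L ^ 4)⁻¹) ≤ max C 0 * (L⁻¹ + (1 + x) ^ 3 * (L ^ 4)⁻¹) :=
        mul_le_mul_of_nonneg_right (le_max_left _ _) hnn
    _ ≤ max C 0 * (2 * (1 + x) ^ 3 * L⁻¹) := mul_le_mul_of_nonneg_left hsum (le_max_right _ _)
    _ = 2 * max C 0 * (1 + x) ^ 3 * L⁻¹ := by ring

/-! ## The (16.15) bookkeeping edge at the parameter (constant-agnostic, R-28 C4) -/

section EdgeE

/-- `τ₃(n) ≥ 0`. [folklore] -/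
private theorem tau3R_nonneg' (n : ℕ) : 0 ≤ tau3R n :=
  Finset.sum_nonneg fun _ _ => Nat.cast_nonneg _

/-- `τ₃(n) ≥ 1` for `n ≥ 1`. [folklore] -/
private theorem one_le_tau3R' {n : ℕ} (hn : 1 ≤ n) : 1 ≤ tau3R n := by
  unfold tau3R
  have h1 : (1 : ℕ) ∈ n.divisors := Nat.one_mem_divisors.mpr (by omega)
  calc (1 : ℝ) = ((1 : ℕ).divisors.card : ℝ) := by simp
    _ ≤ ∑ m ∈ n.divisors, (m.divisors.card : ℝ) :=
        Finset.single_le_sum (f := fun m : ℕ => (m.divisors.card : ℝ)) (fun _ _ => Nat.cast_nonneg _) h1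

/-- `⌈e^L⌉ ≤ D ⇒ L ≤ 𝓛`. [folklore] -/
private theorem le_ell_of_ceil_exp_le' {L : ℝ} {D : ℕ} (hD : ⌈Real.exp L⌉₊ ≤ D) : L ≤ ell D := by
  have h : Real.exp L ≤ D := le_trans (Nat.le_ceil _) (by exact_mod_cast hD)
  exact (Real.le_log_iff_exp_le (lt_of_lt_of_le (Real.exp_pos _) h)).mpr h

/-- `0 < 𝓛 ⇒ 0 < D`. [folklore] -/
private theorem cast_pos_of_ell_pos {D : ℕ} (hℓ : 0 < ell D) : (0 : ℝ) < D := by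
  have : ell D ≠ 0 := hℓ.ne'
  rw [ell] at this
  by_contra h
  push Not at h
  have h0 : (D : ℝ) = 0 := le_antisymm h (Nat.cast_nonneg D)
  exact this (by rw [h0, Real.log_zero])

/-- `D^{−c} ≤ 1/(c𝓛)` (`c, 𝓛 > 0`). [folklore] -/
private theorem rpow_neg_le_inv' {D : ℕ} {c : ℝ} (hc : 0 < c) (hℓ : 0 < ell D) :
    (D : ℝ) ^ (-c) ≤ (c * ell D)⁻¹ := by
  have hD := cast_pos_of_ell_pos hℓ
  rw [Real.rpow_def_of_pos hD, ← ell]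
  have h1 := Real.add_one_le_exp (c * ell D)
  have hpos : 0 < c * ell D := mul_pos hc hℓ
  rw [show ell D * -c = -(c * ell D) by ring, Real.exp_neg]
  exact inv_anti₀ hpos (by linarith)

/-- `D^{−c}𝓛⁶ ≤ 7!/(c⁷𝓛)` (`c, 𝓛 > 0`). [folklore] -/
private theorem rpow_neg_mul_pow_six_le' {D : ℕ} {c : ℝ} (hc : 0 < c) (hℓ : 0 < ell D) :
    (D : ℝ) ^ (-c) * ell D ^ 6 ≤ (Nat.factorial 7 : ℝ) / c ^ 7 * (ell D)⁻¹ := by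
  have hD := cast_pos_of_ell_pos hℓ
  rw [Real.rpow_def_of_pos hD, ← ell, show ell D * -c = -(c * ell D) by ring, Real.exp_neg]
  have hpos : 0 < c * ell D := mul_pos hc hℓ
  have h7 := Real.pow_div_factorial_le_exp (c * ell D) (le_of_lt hpos) 7
  have hexp : (Real.exp (c * ell D))⁻¹ ≤ (Nat.factorial 7 : ℝ) / (c * ell D) ^ 7 := by
    rw [inv_le_comm₀ (Real.exp_pos _) (by positivity), inv_div]
    exact h7
  calc (Real.exp (c * ell D))⁻¹ * ell D ^ 6 ≤ (Nat.factorial 7 : ℝ) / (c * ell D) ^ 7 * ell D ^ 6 := by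
        gcongr
    _ = (Nat.factorial 7 : ℝ) / c ^ 7 * (ell D)⁻¹ := by
        field_simp

open scoped Classical in
/-- **The summed edge to (16.15) at the parameter `e″ = e1pp`** (G-L4t5-1 × F16B-1 × RT-05):
`Step16_u031L → Step16_u037RLE e1pp → Inline16_varpi2WeightSum → Eq16_15E e1pp` — the bookkeeping of
`eq16_15_of_repairL` verbatim with `𝔢ⱼ ↦ 𝔢ⱼ[e1pp]` (the proof never inspects the value of `𝔢ⱼ`).
[cite: Zhang2022LandauSiegel, §16 (16.15) p.94] -/
theorem eq16_15E_of_repairL (e1pp : ℕ → ℂ) (c' : ℝ) (h31 : Step16_u031L c')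
    (h37 : Step16_u037RLE e1pp c') (hS : Inline16_varpi2WeightSum c') : Eq16_15E e1pp c' := by
  obtain ⟨c₁, hc₁, C₁, D₁, h31⟩ := h31
  obtain ⟨c₂, hc₂, C₂, D₂, h37⟩ := h37
  obtain ⟨C₃, D₃, hS⟩ := hS
  refine ⟨|C₁| / c₁ + |C₂| * |C₃| * (1 + (Nat.factorial 7 : ℝ) / c₂ ^ 7),
    max (max D₁ D₂) (max D₃ ⌈Real.exp 1⌉₊), fun D _ χ hD hq hp hA j hj => ?_⟩
  have hD₁ : D₁ ≤ D := le_trans (le_trans (le_max_left _ _) (le_max_left _ _)) hD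
  have hD₂ : D₂ ≤ D := le_trans (le_trans (le_max_right _ _) (le_max_left _ _)) hD
  have hD₃ : D₃ ≤ D := le_trans (le_trans (le_max_left _ _) (le_max_right _ _)) hD
  have hℓ1 : 1 ≤ ell D :=
    le_ell_of_ceil_exp_le' (le_trans (le_trans (le_max_right _ _) (le_max_right _ _)) hD)
  have hℓ0 : 0 < ell D := by linarith
  have e31 := h31 D χ hD₁ hq hp hA j hj
  have eS := hS D χ hD₃ hq hp hA j hj
  -- notation
  set F := (Finset.Ico 1 ⌈bigT D⌉₊).filter (fun n₁ => n₁ ∈ nset (frakq D)) with hF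
  set X := ∑ n ∈ Finset.Ico 1 ⌈bigP D⌉₊, b1coef c' χ n * varpi2 c' χ j n / (n : ℂ) with hX
  set In : ℕ → ℂ := fun n₁ =>
    ∑ n ∈ (Finset.Ico 1 ⌈bigP D⌉₊).filter (fun n => Nat.Coprime n (frakq D)),
      b1coef c' χ (n₁ * n) * varpi2loc c' χ j n / (n : ℂ) with hIn
  -- the per-`n₁` bound
  have e37 : ∀ n₁ ∈ F, ‖In n₁ - frakeE e1pp j * nuConvChi χ n₁‖ ≤
      |C₂| * (tau3R n₁ * (ell D ^ 7)⁻¹ + (D : ℝ) ^ (-c₂)) := by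
    intro n₁ hn₁
    obtain ⟨hIco, hns⟩ := Finset.mem_filter.mp hn₁
    have h1 : 1 ≤ n₁ := (Finset.mem_Ico.mp hIco).1
    have hT : (n₁ : ℝ) < bigT D := Nat.lt_ceil.mp (Finset.mem_Ico.mp hIco).2
    have key := h37 D χ hD₂ hq hp hA j hj n₁ hns hT
    rw [nuConvChi_eq_sum_divisors χ h1]
    refine le_trans key (mul_le_mul_of_nonneg_right (le_abs_self C₂) ?_)
    have := tau3R_nonneg' n₁
    positivity
  -- rewrite the difference
  have hsplit : X - frakeE e1pp j * ∑ n₁ ∈ F, varpi2 c' χ j n₁ * nuConvChi χ n₁ / (n₁ : ℂ) =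
      (X - ∑ n₁ ∈ F, varpi2 c' χ j n₁ / (n₁ : ℂ) * In n₁) +
        ∑ n₁ ∈ F, varpi2 c' χ j n₁ / (n₁ : ℂ) * (In n₁ - frakeE e1pp j * nuConvChi χ n₁) := by
    have e1 : ∑ n₁ ∈ F, varpi2 c' χ j n₁ / (n₁ : ℂ) * (In n₁ - frakeE e1pp j * nuConvChi χ n₁) =
        ∑ n₁ ∈ F, varpi2 c' χ j n₁ / (n₁ : ℂ) * In n₁ -
          ∑ n₁ ∈ F, varpi2 c' χ j n₁ / (n₁ : ℂ) * (frakeE e1pp j * nuConvChi χ n₁) := by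
      rw [← Finset.sum_sub_distrib]
      exact Finset.sum_congr rfl fun _ _ => by ring
    have e2 : frakeE e1pp j * ∑ n₁ ∈ F, varpi2 c' χ j n₁ * nuConvChi χ n₁ / (n₁ : ℂ) =
        ∑ n₁ ∈ F, varpi2 c' χ j n₁ / (n₁ : ℂ) * (frakeE e1pp j * nuConvChi χ n₁) := by
      rw [Finset.mul_sum]
      exact Finset.sum_congr rfl fun _ _ => by ring
    rw [e1, e2]
    ring
  rw [hsplit]
  -- main estimate
  have hterm : ∀ n₁ ∈ F, ‖varpi2 c' χ j n₁ / (n₁ : ℂ) * (In n₁ - frakeE e1pp j * nuConvChi χ n₁)‖ ≤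
      ‖varpi2 c' χ j n₁‖ * tau3R n₁ / n₁ * (|C₂| * (ell D ^ 7)⁻¹) +
        ‖varpi2 c' χ j n₁‖ * tau3R n₁ / n₁ * (|C₂| * (D : ℝ) ^ (-c₂)) := by
    intro n₁ hn₁
    obtain ⟨hIco, _⟩ := Finset.mem_filter.mp hn₁
    have h1 : 1 ≤ n₁ := (Finset.mem_Ico.mp hIco).1
    have hn0 : (0 : ℝ) < n₁ := by exact_mod_cast h1
    rw [norm_mul, norm_div, Complex.norm_natCast]
    have hτ := one_le_tau3R' h1
    have hϖ : 0 ≤ ‖varpi2 c' χ j n₁‖ / n₁ := by positivity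
    calc ‖varpi2 c' χ j n₁‖ / ↑n₁ * ‖In n₁ - frakeE e1pp j * nuConvChi χ n₁‖
        ≤ ‖varpi2 c' χ j n₁‖ / ↑n₁ * (|C₂| * (tau3R n₁ * (ell D ^ 7)⁻¹ + (D : ℝ) ^ (-c₂))) :=
          mul_le_mul_of_nonneg_left (e37 n₁ hn₁) hϖ
      _ = ‖varpi2 c' χ j n₁‖ * tau3R n₁ / n₁ * (|C₂| * (ell D ^ 7)⁻¹) +
            ‖varpi2 c' χ j n₁‖ / n₁ * (|C₂| * (D : ℝ) ^ (-c₂)) := by ring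
      _ ≤ ‖varpi2 c' χ j n₁‖ * tau3R n₁ / n₁ * (|C₂| * (ell D ^ 7)⁻¹) +
            ‖varpi2 c' χ j n₁‖ * tau3R n₁ / n₁ * (|C₂| * (D : ℝ) ^ (-c₂)) := by
          have hdiv : ‖varpi2 c' χ j n₁‖ / n₁ ≤ ‖varpi2 c' χ j n₁‖ * tau3R n₁ / n₁ := by
            apply div_le_div_of_nonneg_right _ hn0.le
            calc ‖varpi2 c' χ j n₁‖ = ‖varpi2 c' χ j n₁‖ * 1 := (mul_one _).symm
              _ ≤ ‖varpi2 c' χ j n₁‖ * tau3R n₁ := mul_le_mul_of_nonneg_left hτ (norm_nonneg _)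
          have hD0 : 0 ≤ |C₂| * (D : ℝ) ^ (-c₂) :=
            mul_nonneg (abs_nonneg _) (Real.rpow_nonneg (Nat.cast_nonneg D) _)
          have := mul_le_mul_of_nonneg_right hdiv hD0
          linarith
  have hsumS : 0 ≤ ∑ n₁ ∈ F, ‖varpi2 c' χ j n₁‖ * tau3R n₁ / n₁ :=
    Finset.sum_nonneg fun n₁ _ => by
      have := tau3R_nonneg' n₁; positivity
  have eS' : ∑ n₁ ∈ F, ‖varpi2 c' χ j n₁‖ * tau3R n₁ / n₁ ≤ |C₃| * ell D ^ 6 :=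
    le_trans eS (mul_le_mul_of_nonneg_right (le_abs_self C₃) (by positivity))
  have hexp1 : (D : ℝ) ^ (-c₁) ≤ (c₁ * ell D)⁻¹ := rpow_neg_le_inv' hc₁ hℓ0
  have hexp2 : (D : ℝ) ^ (-c₂) * ell D ^ 6 ≤ (Nat.factorial 7 : ℝ) / c₂ ^ 7 * (ell D)⁻¹ :=
    rpow_neg_mul_pow_six_le' hc₂ hℓ0
  have hDc₁ : 0 ≤ (D : ℝ) ^ (-c₁) := Real.rpow_nonneg (Nat.cast_nonneg D) _
  have hDc₂ : 0 ≤ (D : ℝ) ^ (-c₂) := Real.rpow_nonneg (Nat.cast_nonneg D) _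
  calc ‖(X - ∑ n₁ ∈ F, varpi2 c' χ j n₁ / (n₁ : ℂ) * In n₁) +
          ∑ n₁ ∈ F, varpi2 c' χ j n₁ / (n₁ : ℂ) * (In n₁ - frakeE e1pp j * nuConvChi χ n₁)‖
      ≤ ‖X - ∑ n₁ ∈ F, varpi2 c' χ j n₁ / (n₁ : ℂ) * In n₁‖ +
          ∑ n₁ ∈ F, ‖varpi2 c' χ j n₁ / (n₁ : ℂ) * (In n₁ - frakeE e1pp j * nuConvChi χ n₁)‖ :=
        le_trans (norm_add_le _ _) (by gcongr; exact norm_sum_le _ _)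
    _ ≤ C₁ * (D : ℝ) ^ (-c₁) +
          ∑ n₁ ∈ F, (‖varpi2 c' χ j n₁‖ * tau3R n₁ / n₁ * (|C₂| * (ell D ^ 7)⁻¹) +
            ‖varpi2 c' χ j n₁‖ * tau3R n₁ / n₁ * (|C₂| * (D : ℝ) ^ (-c₂))) :=
        add_le_add e31 (Finset.sum_le_sum hterm)
    _ = C₁ * (D : ℝ) ^ (-c₁) +
          (∑ n₁ ∈ F, ‖varpi2 c' χ j n₁‖ * tau3R n₁ / n₁) *
            (|C₂| * (ell D ^ 7)⁻¹ + |C₂| * (D : ℝ) ^ (-c₂)) := by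
        rw [Finset.sum_add_distrib, ← Finset.sum_mul, ← Finset.sum_mul]; ring
    _ ≤ |C₁| * (D : ℝ) ^ (-c₁) +
          (|C₃| * ell D ^ 6) * (|C₂| * (ell D ^ 7)⁻¹ + |C₂| * (D : ℝ) ^ (-c₂)) := by
        have i1 : C₁ * (D : ℝ) ^ (-c₁) ≤ |C₁| * (D : ℝ) ^ (-c₁) :=
          mul_le_mul_of_nonneg_right (le_abs_self _) hDc₁
        have i2 : (∑ n₁ ∈ F, ‖varpi2 c' χ j n₁‖ * tau3R n₁ / n₁) *
              (|C₂| * (ell D ^ 7)⁻¹ + |C₂| * (D : ℝ) ^ (-c₂)) ≤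
            (|C₃| * ell D ^ 6) * (|C₂| * (ell D ^ 7)⁻¹ + |C₂| * (D : ℝ) ^ (-c₂)) :=
          mul_le_mul_of_nonneg_right eS' (by positivity)
        linarith
    _ = |C₁| * (D : ℝ) ^ (-c₁) + |C₂| * |C₃| * (ell D ^ 6 * (ell D ^ 7)⁻¹) +
          |C₂| * |C₃| * ((D : ℝ) ^ (-c₂) * ell D ^ 6) := by ring
    _ ≤ |C₁| * (c₁ * ell D)⁻¹ + |C₂| * |C₃| * (ell D)⁻¹ +
          |C₂| * |C₃| * ((Nat.factorial 7 : ℝ) / c₂ ^ 7 * (ell D)⁻¹) := by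
        have e6 : ell D ^ 6 * (ell D ^ 7)⁻¹ = (ell D)⁻¹ := by
          rw [show ell D ^ 7 = ell D ^ 6 * ell D by ring, mul_inv, ← mul_assoc,
            mul_inv_cancel₀ (pow_ne_zero 6 hℓ0.ne'), one_mul]
        rw [e6]
        have i1 := mul_le_mul_of_nonneg_left hexp1 (abs_nonneg C₁)
        have i3 := mul_le_mul_of_nonneg_left hexp2 (mul_nonneg (abs_nonneg C₂) (abs_nonneg C₃))
        linarith
    _ = (|C₁| / c₁ + |C₂| * |C₃| * (1 + (Nat.factorial 7 : ℝ) / c₂ ^ 7)) * (ell D)⁻¹ := by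
        field_simp
        ring


end EdgeE

end Literature.NumberTheory.LFunctions.Zhang2022.Typed.Section16B
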